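import Literature.MathematicalPhysics.QuantumFieldTheory.Balaban1983to89.B9Eq342CovariantResolventAdjointRowLetters
import Literature.MathematicalPhysics.QuantumFieldTheory.Balaban1983to89.B9Eq342GradientRowNaturalPerturbation

/-!
# `Balaban1983to89.B9Eq342CovariantResolventAdjointRow` — T. Bałaban, *Propagators for lattice gauge theories in a background field*, Commun. Math. Phys. **99**
# (1985) 389–434 [Balaban1985BackgroundPropagators] Thm 3.1 (3.42) p. 397, THIRD ENTRY `|(G′(U)∇*_Uλ)(x)| ≤ B₀L^jηe^{−δ₀d(y,y′)}|λ|`, FOR THE COVARIANT MASSIVE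
# RESOLVENT: **THE `cosh`-WEIGHTED ADJOINT (DIVERGENCE) ROW OF `(Δ^η_U + m)⁻¹D*_U` ON THE SMALL-FIELD CLASS, PROVED — for transporter data `R(b)`, `S(b)` with
# `S(b)R(b) = 1`, `⟨R(b)v, u⟩ = ⟨v, S(b)u⟩`, contractions, `‖R(b)w − w‖, ‖S(b)w − w‖ ≤ ε‖w‖`, `‖S(x,μ)w − S(x−e_μ,μ)w‖ ≤ ε′‖w‖`, in the window
# `2d·t²(cosh a − 1) < m`, `P_ν ≥ 2`: if `κ := tε·S_ad·(e^a + 1) < 1` then for EVERY centre `x₀`, every bond datum `f` with `‖f(b)‖ ≤ F·W_{x₀}(b₋)` and every site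
# `‖((Δ_{RS} + m)⁻¹D*_Sf)(x)‖ ≤ A∕(1 − κ)·F·W_{x₀}(x)`, `A = S_ad(1 + λ⁻¹t²d(ε²e^a + ε′)) + λ⁻¹tεde^a`, `λ = m − 2d·t²(cosh a − 1)`, `S_ad = t·Σ_νB_ν` the flat constant** — by the
# resolvent identity around `U = 1`, the divergence-form split of `Δ_{RS} − Δ_1` (`B9Eq342CovariantResolventAdjointRowLetters`), Kato's weighted value row, the flat
# weighted adjoint row (`B5Eq129FreeResolventWeightedAdjointRow`), and an affine bootstrap on the (finite-dimensional, hence a-priori bounded) solution operator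

statement-level skeleton of published theorems with citation tags; proofs where landed; nothing here is a claim about the Yang–Mills mass gap

CITATION HEADER (lean-in-tree rule).  Audit cell `pub-balaban`, sub-cell `t4`, BINDER row NE9; filed by NE9 crux-team LEAF PROVER 01 (`b2b-balaban-t4-ne9-formalise-leaf-01`,
gen 93; bears_on: R4/N22).  Source READ first-hand (`paper:balaban1985-cmp99-background-propagators`, journal page = PDF page + 388): p. 394 (3.23), p. 396 (3.35) (the
small-field class), p. 397 Thm 3.1 (3.42) (third member, «B₀, δ₀ dependent on d and L only»), p. 398 *«All these inequalities are invariant with respect to gauge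
transformations of U. … We will prove the above theorem by constructing a random walk representation»* — NOT reproduced: the road here is a perturbation of the
covariant massive resolvent around the flat one in the weighted sup currency.  Inputs BY NAME: the letters file, `B9Eq323KatoDomination` ([DodziukMathai2006] §1), NE9
leaf-05's flat weighted rows through `B5Eq129FreeResolventWeightedAdjointRow`, `B9Eq342GradientRowNaturalPerturbation.weight_site_(un)shift_le`.  Nothing printed is a
hypothesis; the `[cite: …]` tags are TEXT LOCATIONS.

WHAT IS PROVED (sorry-free; proof lane — 0 `def`, no notation: the weight `Wt`, the flat constant `Sad` and the massive operator `Tm` (with ANY positivity witness) are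
LETTERS PINNED BY EQUATIONS `hWt`, `hSad`, `hTm`, instantiated by `rfl` at the consumer).
* §0 `affine_bootstrap` (private, [folklore]: a monotone, closed property `Pr(Θ)` holding at some `Θ₀ ≥ 0` and improving `Pr(Θ) ⟹ Pr(A + κΘ)`, `0 ≤ κ < 1`, holds at
  `A∕(1 − κ)`); §1 **`greenK_eq_sub_greenK_pert`** (`G_mh = G⁰_mh − G_m((Δ_{RS} − Δ_1)(G⁰_mh))`); §2 **`covLaplace_sub_flat_eq`** (the split in `SiteL2K`);
  §3 **`adjRow_step`** (the row with constant `Θ` ⟹ the row with `A + κΘ`); §4 **`exists_adjRow_apriori`** (finite dimension: SOME constant `Θ₀ ≥ 0`);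
  §5 **`adjRow_covariantResolvent`** (THE ROW, constant `A∕(1 − κ)` for `κ < 1`), **`adjRow_covariantResolvent_half`** (`κ ≤ ½` ⟹ constant `2A`).
HONEST SCOPE.  Abstract transporters on the chain's periodic lattice; the instantiation on the (T4E) binder block (`R = R(U)`, `S = R(U⁻¹)`, `t = η⁻¹`, `ε = 2M_φM_φ′αη`,
`ε′ = O(αη²)` from `‖U(x,μ) − U(x−e_μ,μ)‖ ≤ αη²`, so `tε`, `t²ε′ = O(α)` and `κ < 1` for `α` small — the «sufficiently small field» of Thm 3.1) and the passage
`G_m ↦ G′_k(U)` (`G′_kD*_U = G_mD*_U + G′_k[(m − a′Q̃′†Q̃′)G_mD*_U]`, the OWNER's closed decayed value row) are the next files; no ∇-row, no Hölder row ((3.43)₂ and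
(3.44) remain the located open members behind STOREY H).  Constants crude (every direction's `B_ν` summed; `e^a` for one lattice step).  NOT summit progress (cell pub-balaban: NE9 NOT PRINTED ∕ NOT PROVED; «NE9 ⇐ the named binders»; row WALLED ON A MODEL (O-NE9-1; #5 UNRULED); spine PROVED 0∕9; rung (B)+1 finite
T⁴ — NOT infinite volume, NOT mass gap, NOT BetaPertH, NOT Clay).  HONEST DEPENDENCY (cell line): continuum YM on T⁴ ⇐ BetaPertH ∧ nine spine estimates (0/9 proved); BetaPertH
⇐ (D1) ∧ (D4) ∧ CAP+tail; G-an2-4 gates asym, D1 and NE2/3/4.  NEW file; nothing modified.  Net new unproved facts: 0.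
-/

noncomputable section

open scoped InnerProductSpace ComplexConjugate BigOperators

namespace Literature.MathematicalPhysics.QuantumFieldTheory.Balaban1983to89.B9Eq342CovariantResolventAdjointRow

open B4Sect5Torus (TSite)
open B4TorusKernel.MultiPeriod (circAbs)
open B9SectCLatticeCarrier (Bond bpos btgt shift unshift shift_unshift unshift_shift)
open B9Eq311L2Pairing (WL2)
open B9Eq33CovDerivVector (covDeriv covDiv covDeriv_apply_dir covDiv_apply)
open B11Eq103H1Complex (SiteL2K BondL2K covDerivL2K covDivL2K covLaplaceSiteK greenK apply_greenK greenK_apply equiv_covDerivL2K equiv_covDivL2K)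
open B9Eq342CoshWeightSite (weight_site_pos)
open B9Eq342GradientRowNaturalPerturbation (weight_site_shift_le weight_site_unshift_le)
open B9Eq342CovariantResolventAdjointRowLetters (rePos_covLaplaceSiteK_add norm_apply_le_weighted_of_resolvent norm_apply_le_weighted_of_flat_resolvent_covDiv
  covDiv_sub_covDiv_flat_apply norm_covDiv_sub_covDiv_flat_apply_le covLaplace_sub_flat_eq_covDiv_add norm_q_apply_le norm_s_apply_le)

/-! ## §0 The affine bootstrap (real analysis) -/

/-- **THE AFFINE BOOTSTRAP.**  Let `Pr : ℝ → Prop` be monotone (`Θ ≤ Θ′ → Pr Θ → Pr Θ′`) and closed from above (`(∀ ε > 0, Pr(Θ + ε)) → Pr Θ`); if `Pr Θ₀` for some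
`Θ₀ ≥ 0` and `Pr Θ → Pr(A + κΘ)` for all `Θ ≥ 0` (`0 ≤ A`, `0 ≤ κ < 1`), then `Pr(A∕(1 − κ))`: the iterates `Θ_{n+1} = A + κΘ_n` satisfy
`Θ_n ≤ A∕(1 − κ) + κⁿΘ₀` and `κⁿΘ₀ → 0`. [folklore] -/
private theorem affine_bootstrap {Pr : ℝ → Prop} (hmono : ∀ Θ Θ' : ℝ, Θ ≤ Θ' → Pr Θ → Pr Θ') (hclosed : ∀ Θ : ℝ, (∀ ε : ℝ, 0 < ε → Pr (Θ + ε)) → Pr Θ)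
    {A κ Θ₀ : ℝ} (hA : 0 ≤ A) (hκ0 : 0 ≤ κ) (hκ1 : κ < 1) (hΘ₀ : 0 ≤ Θ₀) (h0 : Pr Θ₀) (hstep : ∀ Θ : ℝ, 0 ≤ Θ → Pr Θ → Pr (A + κ * Θ)) :
    Pr (A / (1 - κ)) := by
  have h1κ : 0 < 1 - κ := sub_pos.mpr hκ1
  have hAk : 0 ≤ A / (1 - κ) := div_nonneg hA h1κ.le
  -- the iterates
  let seq : ℕ → ℝ := fun n => Nat.rec Θ₀ (fun _ Θ => A + κ * Θ) n
  have hseq0 : seq 0 = Θ₀ := rfl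
  have hseqS : ∀ n, seq (n + 1) = A + κ * seq n := fun n => rfl
  have hnn : ∀ n, 0 ≤ seq n := fun n => by induction n with | zero => exact hΘ₀ | succ n ih => rw [hseqS]; positivity
  have hP : ∀ n, Pr (seq n) := fun n => by induction n with | zero => exact h0 | succ n ih => rw [hseqS]; exact hstep _ (hnn n) ih
  have hle : ∀ n, seq n ≤ A / (1 - κ) + κ ^ n * Θ₀ := fun n => by
    induction n with
    | zero => rw [hseq0, pow_zero, one_mul]; linarith
    | succ n ih =>
        rw [hseqS, pow_succ]
        have e : A + κ * (A / (1 - κ) + κ ^ n * Θ₀) = A / (1 - κ) + κ ^ n * κ * Θ₀ := by field_simp; ring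
        linarith [e, mul_le_mul_of_nonneg_left ih hκ0]
  have hPn : ∀ n, Pr (A / (1 - κ) + κ ^ n * Θ₀) := fun n => hmono _ _ (hle n) (hP n)
  refine hclosed _ fun ε hε => ?_
  rcases eq_or_lt_of_le hΘ₀ with hz | hpos
  · have h := hPn 0
    rw [← hz, mul_zero, add_zero] at h
    exact hmono _ _ (by linarith) h
  · obtain ⟨n, hn⟩ := exists_pow_lt_of_lt_one (div_pos hε hpos) hκ1
    exact hmono _ _ (by linarith [(lt_div_iff₀ hpos).1 hn]) (hPn n)

variable {d : ℕ} {P : Fin d → ℕ} [∀ i, NeZero (P i)] {W : Type*} [NormedAddCommGroup W] [InnerProductSpace ℂ W] [FiniteDimensional ℂ W]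
  {c₀ : ℝ} [Fact (0 < c₀)]

/-! ## §1 The resolvent identity around the flat transporters -/

omit [∀ i, NeZero (P i)] in
/-- **`G_mh = G⁰_mh − G_m((Δ_{RS} − Δ_1)(G⁰_mh))`** for `G_m = (Δ_{RS} + m)⁻¹`, `G⁰_m = (Δ_1 + m)⁻¹` (the `greenK` two-sided inverses): with `z = G⁰_mh`,
`(Δ_{RS} + m)z = h + (Δ_{RS} − Δ_1)z`, apply `G_m`. [folklore] [cite: Balaban1985BackgroundPropagators, (3.23) p.394, (3.62) p.402] -/
theorem greenK_eq_sub_greenK_pert (c m : ℂ) (R S : Bond d P → W →ₗ[ℂ] W)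
    (hpos : ∀ x : SiteL2K ℂ d P c₀ W, x ≠ 0 → 0 < RCLike.re ⟪x, ((covLaplaceSiteK (c₀ := c₀) c R S + m • LinearMap.id :
      SiteL2K ℂ d P c₀ W →ₗ[ℂ] SiteL2K ℂ d P c₀ W)) x⟫_ℂ)
    (hpos₁ : ∀ x : SiteL2K ℂ d P c₀ W, x ≠ 0 → 0 < RCLike.re ⟪x, ((covLaplaceSiteK (c₀ := c₀) c (fun _ : Bond d P => (LinearMap.id : W →ₗ[ℂ] W))
      (fun _ => LinearMap.id) + m • LinearMap.id : SiteL2K ℂ d P c₀ W →ₗ[ℂ] SiteL2K ℂ d P c₀ W)) x⟫_ℂ)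
    (h : SiteL2K ℂ d P c₀ W) :
    greenK _ hpos h = greenK _ hpos₁ h - greenK _ hpos (covLaplaceSiteK c R S (greenK _ hpos₁ h) -
      covLaplaceSiteK c (fun _ : Bond d P => (LinearMap.id : W →ₗ[ℂ] W)) (fun _ => LinearMap.id) (greenK _ hpos₁ h)) := by
  set z := greenK _ hpos₁ h with hz
  have h1 : (covLaplaceSiteK (c₀ := c₀) c R S + m • LinearMap.id : SiteL2K ℂ d P c₀ W →ₗ[ℂ] SiteL2K ℂ d P c₀ W) z =
      h + (covLaplaceSiteK c R S z - covLaplaceSiteK c (fun _ : Bond d P => (LinearMap.id : W →ₗ[ℂ] W)) (fun _ => LinearMap.id) z) := by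
    have h0 : (covLaplaceSiteK (c₀ := c₀) c (fun _ : Bond d P => (LinearMap.id : W →ₗ[ℂ] W)) (fun _ => LinearMap.id) + m • LinearMap.id :
        SiteL2K ℂ d P c₀ W →ₗ[ℂ] SiteL2K ℂ d P c₀ W) z = h := by rw [hz, apply_greenK]
    simp only [LinearMap.add_apply, LinearMap.smul_apply, LinearMap.id_apply] at h0 ⊢
    rw [← h0]; abel
  have h2 := congr_arg (greenK _ hpos) h1
  rw [greenK_apply, map_add] at h2
  exact eq_sub_of_add_eq h2.symm

/-! ## §2 The split `(Δ_{RS} − Δ_1)z = D*_Sq + s` as an identity in `SiteL2K` -/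

omit [∀ i, NeZero (P i)] [FiniteDimensional ℂ W] in
/-- **`(Δ_{RS} − Δ_1)z = D*_Sq + s` IN `SiteL2K`** (the letters file's pointwise identity `covLaplace_sub_flat_eq_covDiv_add`, assembled; `S(b)R(b) = 1`), `q` and `s`
read into the weighted spaces. [folklore] [cite: Balaban1985BackgroundPropagators, (3.23) p.394, (3.3) p.391, (3.8) p.392] -/
theorem covLaplace_sub_flat_eq (t : ℝ) (R S : Bond d P → W →ₗ[ℂ] W) (hSR : ∀ b w, S b (R b w) = w) (z : SiteL2K ℂ d P c₀ W) :
    covLaplaceSiteK (t : ℂ) R S z - covLaplaceSiteK (t : ℂ) (fun _ : Bond d P => (LinearMap.id : W →ₗ[ℂ] W)) (fun _ => LinearMap.id) z =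
      covDivL2K ℂ c₀ (t : ℂ) S ((WL2.equiv ℂ (fun _ : Bond d P => c₀) W).symm fun b : Bond d P =>
          (t : ℂ) • ((R b (WL2.equiv ℂ _ W z (btgt b)) - WL2.equiv ℂ _ W z (btgt b)) - (S b (WL2.equiv ℂ _ W z (bpos b)) - WL2.equiv ℂ _ W z (bpos b)))) +
        (WL2.equiv ℂ (fun _ : TSite d P => c₀) W).symm fun x : TSite d P =>
          ((t ^ 2 : ℝ) : ℂ) • ∑ μ, ((S (unshift μ x, μ) (S (unshift μ x, μ) (WL2.equiv ℂ _ W z (unshift μ x)) - WL2.equiv ℂ _ W z (unshift μ x)) -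
              (S (unshift μ x, μ) (WL2.equiv ℂ _ W z (unshift μ x)) - WL2.equiv ℂ _ W z (unshift μ x))) +
            (S (unshift μ x, μ) (WL2.equiv ℂ _ W z x) - S (x, μ) (WL2.equiv ℂ _ W z x))) := by
  refine (WL2.equiv ℂ (fun _ : TSite d P => c₀) W).injective (funext fun x => ?_)
  simp only [WL2.equiv_sub, Pi.sub_apply, WL2.equiv_add, Pi.add_apply, equiv_covDivL2K, Equiv.apply_symm_apply]
  exact covLaplace_sub_flat_eq_covDiv_add t R S hSR z x

/-! ## §3–§5 The row: the step, the a-priori bound, the bootstrap -/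

section Row

variable (t : ℝ) (ht : 0 < t) {m a ε ε' : ℝ} (hm : 0 < m) (ha : 0 ≤ a) (hε : 0 ≤ ε) (hε' : 0 ≤ ε')
  (hlam : 2 * (d : ℝ) * t ^ 2 * (Real.cosh a - 1) < m) (hn : ∀ ν, 2 ≤ P ν)
  (R S : Bond d P → W →ₗ[ℂ] W) (hSR : ∀ b w, S b (R b w) = w)
  (hRn : ∀ b w, ‖R b w‖ ≤ ‖w‖) (hSn : ∀ b w, ‖S b w‖ ≤ ‖w‖)
  (hRε : ∀ b w, ‖R b w - w‖ ≤ ε * ‖w‖) (hSε : ∀ b w, ‖S b w - w‖ ≤ ε * ‖w‖)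
  (hSε' : ∀ (x : TSite d P) (μ : Fin d) (w : W), ‖S (x, μ) w - S (unshift μ x, μ) w‖ ≤ ε' * ‖w‖)
  -- THE LETTERS PINNED BY EQUATIONS (no `def`, no notation): the weight, the flat constant, the massive operator with its positivity witness
  (Wt : TSite d P → TSite d P → ℝ)
  (hWt : ∀ x₀ y, Wt x₀ y = ∏ μ, Real.cosh (a * (circAbs (P μ) ((((x₀ μ : ℕ) : ZMod (P μ)) - ((y μ : ℕ) : ZMod (P μ))).val) : ℝ)))
  (Sad : ℝ)
  (hSad : Sad = t * ∑ ν : Fin d, ((1 + Real.exp (-a)) * ((1 + 2 * t / (P ν * Real.sqrt (m - 2 * ((d : ℝ) - 1) * t ^ 2 * (Real.cosh a - 1)))) /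
            Real.sqrt ((m - 2 * ((d : ℝ) - 1) * t ^ 2 * (Real.cosh a - 1)) ^ 2 + 4 * (m - 2 * ((d : ℝ) - 1) * t ^ 2 * (Real.cosh a - 1)) * t ^ 2)) +
          2 * Real.sinh a / (m - 2 * (d : ℝ) * t ^ 2 * (Real.cosh a - 1))))
  (Tm : SiteL2K ℂ d P c₀ W →ₗ[ℂ] SiteL2K ℂ d P c₀ W) (hTm : Tm = covLaplaceSiteK (t : ℂ) R S + (m : ℂ) • LinearMap.id)
  (hpos : ∀ x : SiteL2K ℂ d P c₀ W, x ≠ 0 → 0 < RCLike.re ⟪x, Tm x⟫_ℂ)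

omit [∀ i, NeZero (P i)] in
include ht ha hlam hSad in
/-- The flat constant `S_ad = t·Σ_νB_ν` is nonnegative in the window. [folklore] [cite: Balaban1984PropagatorsI, (1.29) p.23, p.36] -/
theorem sad_nonneg : 0 ≤ Sad := by
  have hc : 0 ≤ Real.cosh a - 1 := by linarith [Real.one_le_cosh a]
  have hl : 0 < m - 2 * (d : ℝ) * t ^ 2 * (Real.cosh a - 1) := by linarith
  rw [hSad]
  refine mul_nonneg ht.le (Finset.sum_nonneg fun ν _ => add_nonneg ?_ ?_)
  · exact mul_nonneg (by positivity) (div_nonneg (add_nonneg zero_le_one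
      (div_nonneg (by positivity) (mul_nonneg (Nat.cast_nonneg _) (Real.sqrt_nonneg _)))) (Real.sqrt_nonneg _))
  · exact div_nonneg (mul_nonneg zero_le_two (Real.sinh_nonneg_iff.mpr ha)) hl.le

omit [∀ i, NeZero (P i)] in
include hWt in
/-- The weight is positive. [folklore] [cite: Balaban1984PropagatorsI, p.36] -/
theorem wt_pos (x₀ y : TSite d P) : 0 < Wt x₀ y := by rw [hWt]; exact weight_site_pos P a x₀ y

include ht hm ha hε hε' hlam hn hSR hRn hSn hRε hSε hSε' hWt hSad hTm in
/-- **THE STEP OF THE BOOTSTRAP**: if the weighted adjoint row of `G_mD*_S` (`G_m = (Δ_{RS} + m)⁻¹ = greenK Tm`) holds with a constant `Θ` — for every centre `x₀`, every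
`F ≥ 0` and every bond datum `f` with `‖f(b)‖ ≤ F·W_{x₀}(b₋)`, `‖(G_mD*_Sf)(x)‖ ≤ Θ·F·W_{x₀}(x)` — then it holds with `A + κΘ`, `κ = tε·S_ad·(e^a + 1)`,
`A = S_ad·(1 + λ⁻¹t²d(ε²e^a + ε′)) + λ⁻¹tεde^a`, `λ = m − 2d·t²(cosh a − 1)`.  Proof: `G_mD*_Sf = z − G_mD*_Sq − G_ms + G_m(D*_Sf − D*_1f)` with `z = G⁰_mD*_1f`
(resolvent identity + split), the flat adjoint row for `z`, the hypothesis for the `q`-term, Kato's weighted value row for the other two, one weight step `e^a`.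
[folklore] [cite: Balaban1985BackgroundPropagators, Thm 3.1 (3.42) p.397, (3.23) p.394, (3.35) p.396; Balaban1984PropagatorsI, p.36] -/
theorem adjRow_step {Θ : ℝ}
    (hrow : ∀ (x₀ : TSite d P) (f : BondL2K ℂ d P c₀ W) (F : ℝ), 0 ≤ F → (∀ b, ‖WL2.equiv ℂ _ W f b‖ ≤ F * Wt x₀ (bpos b)) →
      ∀ x, ‖WL2.equiv ℂ _ W (greenK Tm hpos (covDivL2K ℂ c₀ (t : ℂ) S f)) x‖ ≤ Θ * F * Wt x₀ x)
    (x₀ : TSite d P) (f : BondL2K ℂ d P c₀ W) (F : ℝ) (hF : 0 ≤ F) (hf : ∀ b, ‖WL2.equiv ℂ _ W f b‖ ≤ F * Wt x₀ (bpos b)) (x : TSite d P) :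
    ‖WL2.equiv ℂ _ W (greenK Tm hpos (covDivL2K ℂ c₀ (t : ℂ) S f)) x‖ ≤
      ((Sad * (1 + (m - 2 * (d : ℝ) * t ^ 2 * (Real.cosh a - 1))⁻¹ * (t ^ 2 * d * (ε ^ 2 * Real.exp a + ε'))) +
          (m - 2 * (d : ℝ) * t ^ 2 * (Real.cosh a - 1))⁻¹ * (t * ε * d * Real.exp a)) +
        (t * ε * Sad * (Real.exp a + 1)) * Θ) * F * Wt x₀ x := by
  have hSad0 : 0 ≤ Sad := sad_nonneg t ht ha hlam Sad hSad
  subst hTm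
  -- positivity of the flat operator: `R = S = 1` are mutually adjoint
  have hRS₁ : ∀ (b : Bond d P) (v u : W), ⟪(fun _ : Bond d P => (LinearMap.id : W →ₗ[ℂ] W)) b v, u⟫_ℂ =
      ⟪v, (fun _ : Bond d P => (LinearMap.id : W →ₗ[ℂ] W)) b u⟫_ℂ := fun _ _ _ => rfl
  have hpos₁ := rePos_covLaplaceSiteK_add (c₀ := c₀) t hm (fun _ : Bond d P => (LinearMap.id : W →ₗ[ℂ] W)) (fun _ => LinearMap.id) hRS₁
  have hlam0 : 0 < m - 2 * (d : ℝ) * t ^ 2 * (Real.cosh a - 1) := by linarith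
  have hea : 1 ≤ Real.exp a := Real.one_le_exp ha
  -- data bound in the product form
  have hf' : ∀ b, ‖WL2.equiv ℂ _ W f b‖ ≤ F * ∏ μ, Real.cosh (a * (circAbs (P μ) ((((x₀ μ : ℕ) : ZMod (P μ)) - ((bpos b μ : ℕ) : ZMod (P μ))).val) : ℝ)) :=
    fun b => by rw [← hWt]; exact hf b
  -- the objects
  set Gm := greenK _ hpos with hGm
  set G0 := greenK _ hpos₁ with hG0
  set z : SiteL2K ℂ d P c₀ W := G0 (covDivL2K ℂ c₀ (t : ℂ) (fun _ : Bond d P => (LinearMap.id : W →ₗ[ℂ] W)) f) with hz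
  set v := WL2.equiv ℂ _ W z with hv
  set q : BondL2K ℂ d P c₀ W := (WL2.equiv ℂ (fun _ : Bond d P => c₀) W).symm fun b : Bond d P =>
      (t : ℂ) • ((R b (v (btgt b)) - v (btgt b)) - (S b (v (bpos b)) - v (bpos b))) with hq
  set s : SiteL2K ℂ d P c₀ W := (WL2.equiv ℂ (fun _ : TSite d P => c₀) W).symm fun x : TSite d P =>
      ((t ^ 2 : ℝ) : ℂ) • ∑ μ, ((S (unshift μ x, μ) (S (unshift μ x, μ) (v (unshift μ x)) - v (unshift μ x)) -
          (S (unshift μ x, μ) (v (unshift μ x)) - v (unshift μ x))) + (S (unshift μ x, μ) (v x) - S (x, μ) (v x))) with hs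
  set Bf : SiteL2K ℂ d P c₀ W := covDivL2K ℂ c₀ (t : ℂ) S f - covDivL2K ℂ c₀ (t : ℂ) (fun _ : Bond d P => (LinearMap.id : W →ₗ[ℂ] W)) f with hBf
  -- THE DECOMPOSITION `G_mD*_Sf = z − G_m(D*_Sq) − G_ms + G_m(Bf)`
  have hdec : Gm (covDivL2K ℂ c₀ (t : ℂ) S f) = z - Gm (covDivL2K ℂ c₀ (t : ℂ) S q) - Gm s + Gm Bf := by
    have e1 : covDivL2K ℂ c₀ (t : ℂ) S f = covDivL2K ℂ c₀ (t : ℂ) (fun _ : Bond d P => (LinearMap.id : W →ₗ[ℂ] W)) f + Bf := by rw [hBf]; abel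
    have e2 : Gm (covDivL2K ℂ c₀ (t : ℂ) (fun _ : Bond d P => (LinearMap.id : W →ₗ[ℂ] W)) f) =
        z - Gm (covLaplaceSiteK (t : ℂ) R S z - covLaplaceSiteK (t : ℂ) (fun _ : Bond d P => (LinearMap.id : W →ₗ[ℂ] W)) (fun _ => LinearMap.id) z) := by
      rw [hGm, hz, hG0]
      exact greenK_eq_sub_greenK_pert (c₀ := c₀) (t : ℂ) (m : ℂ) R S hpos hpos₁ _
    have e3 : covLaplaceSiteK (t : ℂ) R S z - covLaplaceSiteK (t : ℂ) (fun _ : Bond d P => (LinearMap.id : W →ₗ[ℂ] W)) (fun _ => LinearMap.id) z =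
        covDivL2K ℂ c₀ (t : ℂ) S q + s := by rw [hq, hs, hv]; exact covLaplace_sub_flat_eq t R S hSR z
    rw [e1, map_add, e2, e3, map_add]
    abel
  -- THE FLAT ADJOINT ROW for `z`
  have hzeq : covLaplaceSiteK (t : ℂ) (fun _ : Bond d P => (LinearMap.id : W →ₗ[ℂ] W)) (fun _ => LinearMap.id) z + (m : ℂ) • z =
      covDivL2K ℂ c₀ (t : ℂ) (fun _ : Bond d P => (LinearMap.id : W →ₗ[ℂ] W)) f := by
    simpa only [LinearMap.add_apply, LinearMap.smul_apply, LinearMap.id_apply] using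
      apply_greenK hpos₁ (covDivL2K ℂ c₀ (t : ℂ) (fun _ : Bond d P => (LinearMap.id : W →ₗ[ℂ] W)) f)
  have hzrow : ∀ y, ‖v y‖ ≤ Sad * F * Wt x₀ y := fun y => by
    rw [hWt, hSad]; exact norm_apply_le_weighted_of_flat_resolvent_covDiv (c₀ := c₀) t ht hm ha hlam hn hzeq x₀ hf' y
  -- the `q`-term through the hypothesis
  have hqb : ∀ b, ‖WL2.equiv ℂ _ W q b‖ ≤ (t * ε * Sad * (Real.exp a + 1) * F) * Wt x₀ (bpos b) := fun b => by
    rw [hq, Equiv.apply_symm_apply]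
    have h1 := norm_q_apply_le (P := P) t R S hRε hSε v b
    have h2 : ‖v (btgt b)‖ ≤ Sad * F * (Real.exp a * Wt x₀ (bpos b)) := by
      refine (hzrow (btgt b)).trans (mul_le_mul_of_nonneg_left ?_ (mul_nonneg hSad0 hF))
      rw [hWt, hWt]; exact weight_site_shift_le ha x₀ b.1 b.2
    have h3 := hzrow (bpos b)
    rw [abs_of_pos ht] at h1
    calc _ ≤ t * (ε * (‖v (btgt b)‖ + ‖v (bpos b)‖)) := h1
      _ ≤ t * (ε * (Sad * F * (Real.exp a * Wt x₀ (bpos b)) + Sad * F * Wt x₀ (bpos b))) := by gcongr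
      _ = (t * ε * Sad * (Real.exp a + 1) * F) * Wt x₀ (bpos b) := by ring
  have hGq : ‖WL2.equiv ℂ _ W (Gm (covDivL2K ℂ c₀ (t : ℂ) S q)) x‖ ≤ Θ * (t * ε * Sad * (Real.exp a + 1) * F) * Wt x₀ x := by
    rw [hGm]; exact hrow x₀ q _ (by positivity) hqb x
  -- the `s`-term through Kato's weighted value row
  have hsb : ∀ y, ‖WL2.equiv ℂ _ W s y‖ ≤ (t ^ 2 * d * (ε ^ 2 * Real.exp a + ε') * (Sad * F)) *
      ∏ μ, Real.cosh (a * (circAbs (P μ) ((((x₀ μ : ℕ) : ZMod (P μ)) - ((y μ : ℕ) : ZMod (P μ))).val) : ℝ)) := fun y => by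
    rw [hs, Equiv.apply_symm_apply, ← hWt]
    refine (norm_s_apply_le (P := P) t S hSε hSε' hε v y).trans ?_
    have hterm : ∀ μ : Fin d, ε ^ 2 * ‖v (unshift μ y)‖ + ε' * ‖v y‖ ≤ (ε ^ 2 * Real.exp a + ε') * (Sad * F) * Wt x₀ y := fun μ => by
      have h2 : ‖v (unshift μ y)‖ ≤ Sad * F * (Real.exp a * Wt x₀ y) := by
        refine (hzrow (unshift μ y)).trans (mul_le_mul_of_nonneg_left ?_ (mul_nonneg hSad0 hF))
        rw [hWt, hWt]; exact weight_site_unshift_le ha x₀ y μ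
      have h3 := hzrow y
      calc ε ^ 2 * ‖v (unshift μ y)‖ + ε' * ‖v y‖ ≤ ε ^ 2 * (Sad * F * (Real.exp a * Wt x₀ y)) + ε' * (Sad * F * Wt x₀ y) := by gcongr
        _ = (ε ^ 2 * Real.exp a + ε') * (Sad * F) * Wt x₀ y := by ring
    calc t ^ 2 * ∑ μ : Fin d, (ε ^ 2 * ‖v (unshift μ y)‖ + ε' * ‖v y‖)
        ≤ t ^ 2 * ∑ _μ : Fin d, (ε ^ 2 * Real.exp a + ε') * (Sad * F) * Wt x₀ y :=
          mul_le_mul_of_nonneg_left (Finset.sum_le_sum fun μ _ => hterm μ) (sq_nonneg t)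
      _ = (t ^ 2 * d * (ε ^ 2 * Real.exp a + ε') * (Sad * F)) * Wt x₀ y := by rw [Finset.sum_const, Finset.card_univ, Fintype.card_fin, nsmul_eq_mul]; ring
  have hseq : covLaplaceSiteK (t : ℂ) R S (Gm s) + (m : ℂ) • Gm s = s := by
    simpa only [LinearMap.add_apply, LinearMap.smul_apply, LinearMap.id_apply] using apply_greenK hpos s
  have hGs : ‖WL2.equiv ℂ _ W (Gm s) x‖ ≤ (m - 2 * (d : ℝ) * t ^ 2 * (Real.cosh a - 1))⁻¹ * (t ^ 2 * d * (ε ^ 2 * Real.exp a + ε') * (Sad * F)) * Wt x₀ x := by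
    rw [hWt]; exact norm_apply_le_weighted_of_resolvent (c₀ := c₀) t R S hSR hRn hSn hm hlam hseq x₀ (by positivity) hsb x
  -- the `Bf`-term through Kato's weighted value row
  have hBb : ∀ y, ‖WL2.equiv ℂ _ W Bf y‖ ≤ (t * ε * d * Real.exp a * F) *
      ∏ μ, Real.cosh (a * (circAbs (P μ) ((((x₀ μ : ℕ) : ZMod (P μ)) - ((y μ : ℕ) : ZMod (P μ))).val) : ℝ)) := fun y => by
    rw [hBf, WL2.equiv_sub, Pi.sub_apply, equiv_covDivL2K, equiv_covDivL2K, ← hWt]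
    refine (norm_covDiv_sub_covDiv_flat_apply_le (P := P) t S hSε (WL2.equiv ℂ _ W f) y).trans ?_
    rw [abs_of_pos ht]
    have hterm : ∀ μ : Fin d, ‖WL2.equiv ℂ _ W f (unshift μ y, μ)‖ ≤ F * (Real.exp a * Wt x₀ y) := fun μ => by
      refine (hf (unshift μ y, μ)).trans (mul_le_mul_of_nonneg_left ?_ hF)
      rw [hWt, hWt]; exact weight_site_unshift_le ha x₀ y μ
    calc t * (ε * ∑ μ : Fin d, ‖WL2.equiv ℂ _ W f (unshift μ y, μ)‖) ≤ t * (ε * ∑ _μ : Fin d, F * (Real.exp a * Wt x₀ y)) := by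
          gcongr with μ _
          exact hterm μ
      _ = (t * ε * d * Real.exp a * F) * Wt x₀ y := by rw [Finset.sum_const, Finset.card_univ, Fintype.card_fin, nsmul_eq_mul]; ring
  have hBeq : covLaplaceSiteK (t : ℂ) R S (Gm Bf) + (m : ℂ) • Gm Bf = Bf := by
    simpa only [LinearMap.add_apply, LinearMap.smul_apply, LinearMap.id_apply] using apply_greenK hpos Bf
  have hGB : ‖WL2.equiv ℂ _ W (Gm Bf) x‖ ≤ (m - 2 * (d : ℝ) * t ^ 2 * (Real.cosh a - 1))⁻¹ * (t * ε * d * Real.exp a * F) * Wt x₀ x := by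
    rw [hWt]; exact norm_apply_le_weighted_of_resolvent (c₀ := c₀) t R S hSR hRn hSn hm hlam hBeq x₀ (by positivity) hBb x
  -- assemble
  rw [hdec]
  simp only [WL2.equiv_add, WL2.equiv_sub, Pi.add_apply, Pi.sub_apply]
  rw [← hv]
  calc ‖v x - WL2.equiv ℂ _ W (Gm (covDivL2K ℂ c₀ (t : ℂ) S q)) x - WL2.equiv ℂ _ W (Gm s) x + WL2.equiv ℂ _ W (Gm Bf) x‖
      ≤ ‖v x‖ + ‖WL2.equiv ℂ _ W (Gm (covDivL2K ℂ c₀ (t : ℂ) S q)) x‖ + ‖WL2.equiv ℂ _ W (Gm s) x‖ + ‖WL2.equiv ℂ _ W (Gm Bf) x‖ :=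
        (norm_add_le _ _).trans (add_le_add ((norm_sub_le _ _).trans (add_le_add (norm_sub_le _ _) le_rfl)) le_rfl)
    _ ≤ Sad * F * Wt x₀ x + Θ * (t * ε * Sad * (Real.exp a + 1) * F) * Wt x₀ x +
          (m - 2 * (d : ℝ) * t ^ 2 * (Real.cosh a - 1))⁻¹ * (t ^ 2 * d * (ε ^ 2 * Real.exp a + ε') * (Sad * F)) * Wt x₀ x +
          (m - 2 * (d : ℝ) * t ^ 2 * (Real.cosh a - 1))⁻¹ * (t * ε * d * Real.exp a * F) * Wt x₀ x :=
        add_le_add (add_le_add (add_le_add (hzrow x) hGq) hGs) hGB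
    _ = _ := by ring

include hWt in
/-- **THE A-PRIORI BOUND (finite dimension)**: the weighted adjoint row of `G_mD*_S` holds with SOME constant `Θ₀ ≥ 0` — `G_mD*_S` is a linear map between the
finite-dimensional weighted `L²` spaces (operator norm), `c₀‖v(x)‖² ≤ ‖v‖²`, `‖f‖² ≤ |bonds|·c₀·(F·max W)²`, and `W_{x₀} ≥ 1`.  (The bootstrap turns ANY such constant
into the explicit one.) [folklore] [cite: Balaban1985BackgroundPropagators, (3.11) p.392, Thm 3.1 (3.42) p.397] -/
theorem exists_adjRow_apriori : ∃ Θ₀ : ℝ, 0 ≤ Θ₀ ∧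
    ∀ (x₀ : TSite d P) (f : BondL2K ℂ d P c₀ W) (F : ℝ), 0 ≤ F → (∀ b, ‖WL2.equiv ℂ _ W f b‖ ≤ F * Wt x₀ (bpos b)) →
      ∀ x, ‖WL2.equiv ℂ _ W (greenK Tm hpos (covDivL2K ℂ c₀ (t : ℂ) S f)) x‖ ≤ Θ₀ * F * Wt x₀ x := by
  classical
  have hc₀ : 0 < c₀ := Fact.out
  set T : BondL2K ℂ d P c₀ W →ₗ[ℂ] SiteL2K ℂ d P c₀ W := greenK Tm hpos ∘ₗ covDivL2K ℂ c₀ (t : ℂ) S with hT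
  set Tc := LinearMap.toContinuousLinearMap T with hTc
  -- the weight is bounded on the finite lattice and at least `1`
  have hW1 : ∀ x₀ y : TSite d P, 1 ≤ Wt x₀ y := fun x₀ y => by
    have h := Finset.prod_le_prod (s := (Finset.univ : Finset (Fin d))) (fun _ _ => zero_le_one)
      (fun μ _ => Real.one_le_cosh (a * (circAbs (P μ) ((((x₀ μ : ℕ) : ZMod (P μ)) - ((y μ : ℕ) : ZMod (P μ))).val) : ℝ)))
    rwa [Finset.prod_const_one, ← hWt] at h
  obtain ⟨x₁⟩ : Nonempty (TSite d P) := ⟨fun i => ⟨0, Nat.pos_of_ne_zero (NeZero.ne (P i))⟩⟩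
  have hne : (Finset.univ : Finset (TSite d P × TSite d P)).Nonempty := ⟨(x₁, x₁), Finset.mem_univ _⟩
  set Wmax : ℝ := Finset.univ.sup' hne (fun p : TSite d P × TSite d P => Wt p.1 p.2)
  have hWle : ∀ x₀ y : TSite d P, Wt x₀ y ≤ Wmax := fun x₀ y =>
    Finset.le_sup' (fun p : TSite d P × TSite d P => Wt p.1 p.2) (Finset.mem_univ (x₀, y))
  have hWmax0 : 0 ≤ Wmax := (zero_le_one.trans (hW1 x₁ x₁)).trans (hWle x₁ x₁)
  refine ⟨‖Tc‖ * Real.sqrt (Fintype.card (Bond d P) * c₀) / Real.sqrt c₀ * Wmax, by positivity, ?_⟩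
  intro x₀ f F hF hf x
  have hTf : greenK Tm hpos (covDivL2K ℂ c₀ (t : ℂ) S f) = Tc f := by
    rw [hTc, LinearMap.coe_toContinuousLinearMap', hT, LinearMap.comp_apply]
  rw [hTf]
  -- pointwise ≤ weighted `L²`
  have h1 : ‖WL2.equiv ℂ _ W (Tc f) x‖ ≤ ‖Tc f‖ / Real.sqrt c₀ := by
    rw [le_div_iff₀ (Real.sqrt_pos.2 hc₀)]
    have h := WL2.weight_mul_norm_sq_apply_le (𝕜 := ℂ) (w := fun _ : TSite d P => c₀) (Tc f) x
    have h' : (‖WL2.equiv ℂ _ W (Tc f) x‖ * Real.sqrt c₀) ^ 2 ≤ ‖Tc f‖ ^ 2 := by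
      rw [mul_pow, Real.sq_sqrt hc₀.le, mul_comm]; exact h
    exact (pow_le_pow_iff_left₀ (by positivity) (norm_nonneg _) two_ne_zero).1 h'
  -- the weighted `L²` size of the data
  have h2 : ‖f‖ ≤ Real.sqrt (Fintype.card (Bond d P) * c₀) * (F * Wmax) := by
    have hsq : ‖f‖ ^ 2 ≤ (Real.sqrt (Fintype.card (Bond d P) * c₀) * (F * Wmax)) ^ 2 := by
      rw [WL2.norm_sq (𝕜 := ℂ) (w := fun _ : Bond d P => c₀) f, mul_pow, Real.sq_sqrt (by positivity)]
      calc ∑ b : Bond d P, c₀ * ‖WL2.equiv ℂ _ W f b‖ ^ 2 ≤ ∑ _b : Bond d P, c₀ * (F * Wmax) ^ 2 :=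
            Finset.sum_le_sum fun b _ => mul_le_mul_of_nonneg_left
              (pow_le_pow_left₀ (norm_nonneg _) ((hf b).trans (mul_le_mul_of_nonneg_left (hWle _ _) hF)) 2) hc₀.le
        _ = Fintype.card (Bond d P) * c₀ * (F * Wmax) ^ 2 := by
            rw [Finset.sum_const, Finset.card_univ, nsmul_eq_mul]; ring
    exact (pow_le_pow_iff_left₀ (norm_nonneg _) (by positivity) two_ne_zero).1 hsq
  have h3 : ‖Tc f‖ ≤ ‖Tc‖ * ‖f‖ := Tc.le_opNorm f
  calc ‖WL2.equiv ℂ _ W (Tc f) x‖ ≤ ‖Tc f‖ / Real.sqrt c₀ := h1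
    _ ≤ ‖Tc‖ * (Real.sqrt (Fintype.card (Bond d P) * c₀) * (F * Wmax)) / Real.sqrt c₀ := by
        gcongr
        exact h3.trans (mul_le_mul_of_nonneg_left h2 (norm_nonneg Tc))
    _ = ‖Tc‖ * Real.sqrt (Fintype.card (Bond d P) * c₀) / Real.sqrt c₀ * Wmax * F * 1 := by ring
    _ ≤ ‖Tc‖ * Real.sqrt (Fintype.card (Bond d P) * c₀) / Real.sqrt c₀ * Wmax * F * Wt x₀ x :=
        mul_le_mul_of_nonneg_left (hW1 x₀ x) (by positivity)

include ht hm ha hε hε' hlam hn hSR hRn hSn hRε hSε hSε' hWt hSad hTm in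
/-- **THE `cosh`-WEIGHTED ADJOINT ROW OF THE COVARIANT MASSIVE RESOLVENT** ([B9] Thm 3.1 (3.42), third entry, for `(Δ^η_U + m)⁻¹D*_U` on the small-field
class, abstract transporters): in the window (`t > 0`, `m > 0`, `a ≥ 0`, `2d·t²(cosh a − 1) < m`, `P_ν ≥ 2`), for transporter data `R`, `S` with `SR = 1`,
contractions, `‖Rw − w‖, ‖Sw − w‖ ≤ ε‖w‖`, `‖S(x,μ)w − S(x−e_μ,μ)w‖ ≤ ε′‖w‖`, ANY positivity witness of `Tm = Δ_{RS} + m`, IF `κ := tε·S_ad·(e^a + 1) < 1` THEN for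
every centre `x₀`, every `F ≥ 0`, every bond datum with `‖f(b)‖ ≤ F·W_{x₀}(b₋)` and every site `x`:
`‖((Δ_{RS} + m)⁻¹D*_Sf)(x)‖ ≤ A∕(1 − κ)·F·W_{x₀}(x)`, `A = S_ad(1 + λ⁻¹t²d(ε²e^a + ε′)) + λ⁻¹tεde^a` — the affine bootstrap (§0) on the step (§3) from the
a-priori bound (§4). [cite: Balaban1985BackgroundPropagators, Thm 3.1 (3.42) p.397, (3.23) p.394, (3.35) p.396; Balaban1984PropagatorsI, (1.29) p.23, p.36] -/
theorem adjRow_covariantResolvent (hκ : t * ε * Sad * (Real.exp a + 1) < 1)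
    (x₀ : TSite d P) (f : BondL2K ℂ d P c₀ W) (F : ℝ) (hF : 0 ≤ F) (hf : ∀ b, ‖WL2.equiv ℂ _ W f b‖ ≤ F * Wt x₀ (bpos b)) (x : TSite d P) :
    ‖WL2.equiv ℂ _ W (greenK Tm hpos (covDivL2K ℂ c₀ (t : ℂ) S f)) x‖ ≤
      ((Sad * (1 + (m - 2 * (d : ℝ) * t ^ 2 * (Real.cosh a - 1))⁻¹ * (t ^ 2 * d * (ε ^ 2 * Real.exp a + ε'))) +
          (m - 2 * (d : ℝ) * t ^ 2 * (Real.cosh a - 1))⁻¹ * (t * ε * d * Real.exp a)) /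
        (1 - t * ε * Sad * (Real.exp a + 1))) * F * Wt x₀ x := by
  have hlam0 : 0 < m - 2 * (d : ℝ) * t ^ 2 * (Real.cosh a - 1) := by linarith
  have hSad0 : 0 ≤ Sad := sad_nonneg t ht ha hlam Sad hSad
  have hW0 : ∀ x₀ y : TSite d P, 0 < Wt x₀ y := wt_pos (a := a) Wt hWt
  obtain ⟨Θ₀, hΘ₀, h0⟩ := exists_adjRow_apriori (P := P) (c₀ := c₀) (W := W) t (a := a) S Wt hWt Tm hpos
  have key := affine_bootstrap
    (Pr := fun Θ : ℝ => ∀ (x₀ : TSite d P) (f : BondL2K ℂ d P c₀ W) (F : ℝ), 0 ≤ F → (∀ b, ‖WL2.equiv ℂ _ W f b‖ ≤ F * Wt x₀ (bpos b)) →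
      ∀ x, ‖WL2.equiv ℂ _ W (greenK Tm hpos (covDivL2K ℂ c₀ (t : ℂ) S f)) x‖ ≤ Θ * F * Wt x₀ x)
    (fun Θ Θ' hle hP x₀ f F hF hf x => (hP x₀ f F hF hf x).trans
      (mul_le_mul_of_nonneg_right (mul_le_mul_of_nonneg_right hle hF) (hW0 x₀ x).le))
    (fun Θ hP x₀ f F hF hf x => by
      refine le_of_forall_pos_le_add fun δ hδ => ?_
      rcases eq_or_lt_of_le (mul_nonneg hF (hW0 x₀ x).le) with h0' | hpos'
      · have h := hP 1 one_pos x₀ f F hF hf x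
        rw [mul_assoc, ← h0', mul_zero] at h ⊢; rw [zero_add]; exact h.trans hδ.le
      · have h := hP (δ / (F * Wt x₀ x)) (div_pos hδ hpos') x₀ f F hF hf x
        have e : (Θ + δ / (F * Wt x₀ x)) * F * Wt x₀ x = Θ * F * Wt x₀ x + δ / (F * Wt x₀ x) * (F * Wt x₀ x) := by ring
        rw [div_mul_cancel₀ _ hpos'.ne'] at e
        linarith [e])
    (A := Sad * (1 + (m - 2 * (d : ℝ) * t ^ 2 * (Real.cosh a - 1))⁻¹ * (t ^ 2 * d * (ε ^ 2 * Real.exp a + ε'))) +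
      (m - 2 * (d : ℝ) * t ^ 2 * (Real.cosh a - 1))⁻¹ * (t * ε * d * Real.exp a))
    (κ := t * ε * Sad * (Real.exp a + 1)) (by positivity) (by positivity) hκ hΘ₀ h0
    (fun Θ _ hP x₀ f F hF hf x =>
      adjRow_step (P := P) (c₀ := c₀) t ht hm ha hε hε' hlam hn R S hSR hRn hSn hRε hSε hSε' Wt hWt Sad hSad Tm hTm hpos hP x₀ f F hF hf x)
  exact key x₀ f F hF hf x

include ht hm ha hε hε' hlam hn hSR hRn hSn hRε hSε hSε' hWt hSad hTm in
/-- **… WITH THE CONSTANT `2A` WHEN `κ ≤ ½`** (the consumer's form: on the (T4E) block `tε = 2M_φM_φ′α`, so `κ ≤ ½` is a smallness of `α` alone, height- and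
volume-free). [cite: Balaban1985BackgroundPropagators, Thm 3.1 (3.42) p.397, (3.35) p.396] -/
theorem adjRow_covariantResolvent_half (hκ : t * ε * Sad * (Real.exp a + 1) ≤ 1 / 2)
    (x₀ : TSite d P) (f : BondL2K ℂ d P c₀ W) (F : ℝ) (hF : 0 ≤ F) (hf : ∀ b, ‖WL2.equiv ℂ _ W f b‖ ≤ F * Wt x₀ (bpos b)) (x : TSite d P) :
    ‖WL2.equiv ℂ _ W (greenK Tm hpos (covDivL2K ℂ c₀ (t : ℂ) S f)) x‖ ≤
      (2 * (Sad * (1 + (m - 2 * (d : ℝ) * t ^ 2 * (Real.cosh a - 1))⁻¹ * (t ^ 2 * d * (ε ^ 2 * Real.exp a + ε'))) +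
          (m - 2 * (d : ℝ) * t ^ 2 * (Real.cosh a - 1))⁻¹ * (t * ε * d * Real.exp a))) * F * Wt x₀ x := by
  have hlam0 : 0 < m - 2 * (d : ℝ) * t ^ 2 * (Real.cosh a - 1) := by linarith
  have hSad0 : 0 ≤ Sad := sad_nonneg t ht ha hlam Sad hSad
  have h := adjRow_covariantResolvent (P := P) (c₀ := c₀) t ht hm ha hε hε' hlam hn R S hSR hRn hSn hRε hSε hSε' Wt hWt Sad hSad Tm hTm hpos
    (by linarith) x₀ f F hF hf x
  refine h.trans (mul_le_mul_of_nonneg_right (mul_le_mul_of_nonneg_right ?_ hF) (wt_pos (a := a) Wt hWt x₀ x).le)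
  rw [div_le_iff₀ (by linarith)]
  have hA : 0 ≤ Sad * (1 + (m - 2 * (d : ℝ) * t ^ 2 * (Real.cosh a - 1))⁻¹ * (t ^ 2 * d * (ε ^ 2 * Real.exp a + ε'))) +
      (m - 2 * (d : ℝ) * t ^ 2 * (Real.cosh a - 1))⁻¹ * (t * ε * d * Real.exp a) := by positivity
  nlinarith

end Row

end Literature.MathematicalPhysics.QuantumFieldTheory.Balaban1983to89.B9Eq342CovariantResolventAdjointRow

end
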